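import Summits.CriticalPhenomena.PercolationContinuityZ3.Theorems.SahiMasterFamilyPrincipalCapBetaSmall
import Literature.Probability.Percolation.FoldingFibresHarris

/-!
# The upper master inequality at orders three and four: `E_n ≤ (n−1)!·(μ(⋂A_i) − ∏ μ(A_i))`

Unit `prim-masterthm-p4` (gen 13; crux anchor stmt-CriticalPhenomena-4575, helper work; memo
`run/shared/lean/prim/prim-masterthm/prim-masterthm-p4/P4-GEN13-REPORT.md` §6).

Sahi's conjecture `C_n` [Sahi2008, Conj. 5] is the LOWER bound `E_n ≥ 0`.  This file records the complementary UPPER bound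
("U(n)" of the memo): for increasing events under a product measure,
  `E_3(A,B,C) ≤ 2·(μ(A∩B∩C) − μ(A)μ(B)μ(C))`   (`sahiE3_le_top_gap`),
  `E_4(A,B,C,D) ≤ 6·(μ(A∩B∩C∩D) − μ(A)μ(B)μ(C)μ(D))`   (`sahiE4_le_top_gap`),
with equality for independent events; both follow from Harris' inequality alone (order three: `Σ μ(A)μ(B∩C) ≥ 3∏μ`; order
four: a covering of the six products `μ(A_i)μ(A_j)μ(A_k∩A_l)` by the eight terms `2μ(A_i)μ(A_j∩A_k∩A_l)` plus `μ(A_i∩A_j)μ(A_k∩A_l) ≥ ∏μ`).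
The same inequalities hold for every SUPERMULTIPLICATIVE set function (`phiSet_three_le_top_gap`, `phiSet_four_le_top_gap`, in the
vocabulary of `…PrincipalCapBeta/BetaSmall`).  CONJECTURE U(n) (memo §6; numerically true for supermultiplicative β, n ≤ 7; for events
it follows from `C_{≤ n−2}` by the `(12)`-transposition involution): `Φ_n(β) ≤ (n−1)!(β_⊤ − ∏_i β_i)` for every n.  Not asserted here.
HONEST FRAMING: upper bounds only; `C_n` (the lower bound) remains OPEN for n ≥ 3 in general.  Axioms standard. [this work]
-/

noncomputable section

open scoped Classical

namespace Summit.CriticalPhenomena.PercolationContinuityZ3.Theorems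

namespace UpperMaster

open Finset Function MeasureTheory
open Literature.Combinatorics.Sahi2008
open Literature.Probability.LatticeModels (prodBernoulli sahiE3 sahiE3_def sahiE4 sahiE4_def)
open Literature.Probability.Percolation (prodBernoulli_harris_via_fibres)

variable {ι : Type} [Fintype ι]

/-- **U(3) for events**: `E_3(A,B,C) ≤ 2(μ(A∩B∩C) − μ(A)μ(B)μ(C))` for increasing events under a product measure. [this work] -/
theorem sahiE3_le_top_gap (p : ι → unitInterval) {A B C : Set (Set ι)} (hA : IsUpperSet A) (hB : IsUpperSet B)
    (hC : IsUpperSet C) :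
    sahiE3 (prodBernoulli p) A B C ≤
      2 * ((prodBernoulli p).real (A ∩ B ∩ C) - (prodBernoulli p).real A * (prodBernoulli p).real B * (prodBernoulli p).real C) := by
  set μ := prodBernoulli p with hμ
  have kBC := prodBernoulli_harris_via_fibres p hB hC
  have kAC := prodBernoulli_harris_via_fibres p hA hC
  have kAB := prodBernoulli_harris_via_fibres p hA hB
  have a0 : 0 ≤ μ.real A := measureReal_nonneg
  have b0 : 0 ≤ μ.real B := measureReal_nonneg
  have c0 : 0 ≤ μ.real C := measureReal_nonneg
  have t1 : μ.real A * μ.real B * μ.real C ≤ μ.real A * μ.real (B ∩ C) :=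
    calc μ.real A * μ.real B * μ.real C = μ.real A * (μ.real B * μ.real C) := by ring
      _ ≤ μ.real A * μ.real (B ∩ C) := mul_le_mul_of_nonneg_left kBC a0
  have t2 : μ.real A * μ.real B * μ.real C ≤ μ.real B * μ.real (A ∩ C) :=
    calc μ.real A * μ.real B * μ.real C = μ.real B * (μ.real A * μ.real C) := by ring
      _ ≤ μ.real B * μ.real (A ∩ C) := mul_le_mul_of_nonneg_left kAC b0
  have t3 : μ.real A * μ.real B * μ.real C ≤ μ.real C * μ.real (A ∩ B) :=
    calc μ.real A * μ.real B * μ.real C = μ.real C * (μ.real A * μ.real B) := by ring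
      _ ≤ μ.real C * μ.real (A ∩ B) := mul_le_mul_of_nonneg_left kAB c0
  rw [sahiE3_def]
  linarith [t1, t2, t3]

omit [Fintype ι] in
/-- Re-association of a triple intersection (plumbing). [folklore] -/
theorem inter3_rot (X Y Z : Set (Set ι)) : X ∩ Y ∩ Z = Y ∩ (X ∩ Z) := by
  ext ω; simp only [Set.mem_inter_iff]; tauto

/-- **U(4) for events**: `E_4(A,B,C,D) ≤ 6(μ(A∩B∩C∩D) − μ(A)μ(B)μ(C)μ(D))` for increasing events under a product measure. [this work] -/
theorem sahiE4_le_top_gap (p : ι → unitInterval) {A B C D : Set (Set ι)} (hA : IsUpperSet A) (hB : IsUpperSet B)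
    (hC : IsUpperSet C) (hD : IsUpperSet D) :
    sahiE4 (prodBernoulli p) A B C D ≤
      6 * ((prodBernoulli p).real (A ∩ B ∩ C ∩ D) -
        (prodBernoulli p).real A * (prodBernoulli p).real B * (prodBernoulli p).real C * (prodBernoulli p).real D) := by
  set μ := prodBernoulli p with hμ
  have a0 : 0 ≤ μ.real A := measureReal_nonneg
  have b0 : 0 ≤ μ.real B := measureReal_nonneg
  have c0 : 0 ≤ μ.real C := measureReal_nonneg
  have d0 : 0 ≤ μ.real D := measureReal_nonneg
  -- Harris for pairs
  have kAB := prodBernoulli_harris_via_fibres p hA hB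
  have kAC := prodBernoulli_harris_via_fibres p hA hC
  have kAD := prodBernoulli_harris_via_fibres p hA hD
  have kBC := prodBernoulli_harris_via_fibres p hB hC
  have kBD := prodBernoulli_harris_via_fibres p hB hD
  have kCD := prodBernoulli_harris_via_fibres p hC hD
  -- Harris for (single, pair-intersection), re-associated to the shape of `sahiE4_def`
  have hB_CD : μ.real B * μ.real (C ∩ D) ≤ μ.real (B ∩ C ∩ D) := by
    have h := prodBernoulli_harris_via_fibres p hB (hC.inter hD); rwa [← Set.inter_assoc] at h
  have hC_BD : μ.real C * μ.real (B ∩ D) ≤ μ.real (B ∩ C ∩ D) := by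
    have h := prodBernoulli_harris_via_fibres p hC (hB.inter hD); rwa [← inter3_rot] at h
  have hA_BC : μ.real A * μ.real (B ∩ C) ≤ μ.real (A ∩ B ∩ C) := by
    have h := prodBernoulli_harris_via_fibres p hA (hB.inter hC); rwa [← Set.inter_assoc] at h
  have hC_AD : μ.real C * μ.real (A ∩ D) ≤ μ.real (A ∩ C ∩ D) := by
    have h := prodBernoulli_harris_via_fibres p hC (hA.inter hD); rwa [← inter3_rot] at h
  have hD_AC : μ.real D * μ.real (A ∩ C) ≤ μ.real (A ∩ C ∩ D) := by
    have h := prodBernoulli_harris_via_fibres p (hA.inter hC) hD; rw [mul_comm]; exact h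
  have hD_AB : μ.real D * μ.real (A ∩ B) ≤ μ.real (A ∩ B ∩ D) := by
    have h := prodBernoulli_harris_via_fibres p (hA.inter hB) hD; rw [mul_comm]; exact h
  -- the products used by the covering argument (stated in the monomial shapes of `sahiE4_def`)
  have t12 : μ.real A * μ.real B * μ.real (C ∩ D) ≤ μ.real A * μ.real (B ∩ C ∩ D) :=
    calc μ.real A * μ.real B * μ.real (C ∩ D) = μ.real A * (μ.real B * μ.real (C ∩ D)) := by ring
      _ ≤ μ.real A * μ.real (B ∩ C ∩ D) := mul_le_mul_of_nonneg_left hB_CD a0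
  have t13 : μ.real A * μ.real C * μ.real (B ∩ D) ≤ μ.real A * μ.real (B ∩ C ∩ D) :=
    calc μ.real A * μ.real C * μ.real (B ∩ D) = μ.real A * (μ.real C * μ.real (B ∩ D)) := by ring
      _ ≤ μ.real A * μ.real (B ∩ C ∩ D) := mul_le_mul_of_nonneg_left hC_BD a0
  have t14 : μ.real A * μ.real D * μ.real (B ∩ C) ≤ μ.real D * μ.real (A ∩ B ∩ C) :=
    calc μ.real A * μ.real D * μ.real (B ∩ C) = μ.real D * (μ.real A * μ.real (B ∩ C)) := by ring
      _ ≤ μ.real D * μ.real (A ∩ B ∩ C) := mul_le_mul_of_nonneg_left hA_BC d0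
  have t23 : μ.real B * μ.real C * μ.real (A ∩ D) ≤ μ.real B * μ.real (A ∩ C ∩ D) :=
    calc μ.real B * μ.real C * μ.real (A ∩ D) = μ.real B * (μ.real C * μ.real (A ∩ D)) := by ring
      _ ≤ μ.real B * μ.real (A ∩ C ∩ D) := mul_le_mul_of_nonneg_left hC_AD b0
  have t24 : μ.real B * μ.real D * μ.real (A ∩ C) ≤ μ.real B * μ.real (A ∩ C ∩ D) :=
    calc μ.real B * μ.real D * μ.real (A ∩ C) = μ.real B * (μ.real D * μ.real (A ∩ C)) := by ring
      _ ≤ μ.real B * μ.real (A ∩ C ∩ D) := mul_le_mul_of_nonneg_left hD_AC b0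
  have t34 : μ.real C * μ.real D * μ.real (A ∩ B) ≤ μ.real C * μ.real (A ∩ B ∩ D) :=
    calc μ.real C * μ.real D * μ.real (A ∩ B) = μ.real C * (μ.real D * μ.real (A ∩ B)) := by ring
      _ ≤ μ.real C * μ.real (A ∩ B ∩ D) := mul_le_mul_of_nonneg_left hD_AB c0
  -- leftovers and pairings are at least the product of the four probabilities
  have l3 : μ.real A * μ.real B * μ.real C * μ.real D ≤ μ.real C * μ.real (A ∩ B ∩ D) :=
    calc μ.real A * μ.real B * μ.real C * μ.real D = μ.real C * (μ.real D * (μ.real A * μ.real B)) := by ring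
      _ ≤ μ.real C * (μ.real D * μ.real (A ∩ B)) :=
          mul_le_mul_of_nonneg_left (mul_le_mul_of_nonneg_left kAB d0) c0
      _ ≤ μ.real C * μ.real (A ∩ B ∩ D) := mul_le_mul_of_nonneg_left hD_AB c0
  have l4 : μ.real A * μ.real B * μ.real C * μ.real D ≤ μ.real D * μ.real (A ∩ B ∩ C) :=
    calc μ.real A * μ.real B * μ.real C * μ.real D = μ.real D * (μ.real A * (μ.real B * μ.real C)) := by ring
      _ ≤ μ.real D * (μ.real A * μ.real (B ∩ C)) :=
          mul_le_mul_of_nonneg_left (mul_le_mul_of_nonneg_left kBC a0) d0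
      _ ≤ μ.real D * μ.real (A ∩ B ∩ C) := mul_le_mul_of_nonneg_left hA_BC d0
  have q1 : μ.real A * μ.real B * μ.real C * μ.real D ≤ μ.real (A ∩ B) * μ.real (C ∩ D) :=
    calc μ.real A * μ.real B * μ.real C * μ.real D = (μ.real A * μ.real B) * (μ.real C * μ.real D) := by ring
      _ ≤ μ.real (A ∩ B) * μ.real (C ∩ D) := mul_le_mul kAB kCD (mul_nonneg c0 d0) measureReal_nonneg
  have q2 : μ.real A * μ.real B * μ.real C * μ.real D ≤ μ.real (A ∩ C) * μ.real (B ∩ D) :=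
    calc μ.real A * μ.real B * μ.real C * μ.real D = (μ.real A * μ.real C) * (μ.real B * μ.real D) := by ring
      _ ≤ μ.real (A ∩ C) * μ.real (B ∩ D) := mul_le_mul kAC kBD (mul_nonneg b0 d0) measureReal_nonneg
  have q3 : μ.real A * μ.real B * μ.real C * μ.real D ≤ μ.real (A ∩ D) * μ.real (B ∩ C) :=
    calc μ.real A * μ.real B * μ.real C * μ.real D = (μ.real A * μ.real D) * (μ.real B * μ.real C) := by ring
      _ ≤ μ.real (A ∩ D) * μ.real (B ∩ C) := mul_le_mul kAD kBC (mul_nonneg b0 c0) measureReal_nonneg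
  rw [sahiE4_def]
  linarith [t12, t13, t14, t23, t24, t34, l3, l4, q1, q2, q3]

/-! ### The same for supermultiplicative set functions (abstract U(3), U(4)) -/

/-- **Abstract U(3)**: `Φ_3(β) ≤ 2(β_⊤ − β₀β₁β₂)` for every nonnegative supermultiplicative set function on `Finset (Fin 3)`. [this work] -/
theorem phiSet_three_le_top_gap (β : Finset (Fin 3) → ℝ) (h0 : ∀ B, 0 ≤ β B) (hsup : ∀ S T, β S * β T ≤ β (S ∪ T)) :
    PrincipalCapBeta.phiSet 3 β ≤ 2 * (β univ - β {0} * β {1} * β {2}) := by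
  rw [PrincipalCapBeta.phiSet_three]
  have k12 : β {1} * β {2} ≤ β {1, 2} := by simpa using hsup {1} {2}
  have k02 : β {0} * β {2} ≤ β {0, 2} := by simpa using hsup {0} {2}
  have k01 : β {0} * β {1} ≤ β {0, 1} := by simpa using hsup {0} {1}
  have t1 : β {0} * β {1} * β {2} ≤ β {0} * β {1, 2} :=
    calc β {0} * β {1} * β {2} = β {0} * (β {1} * β {2}) := by ring
      _ ≤ β {0} * β {1, 2} := mul_le_mul_of_nonneg_left k12 (h0 {0})
  have t2 : β {0} * β {1} * β {2} ≤ β {1} * β {0, 2} :=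
    calc β {0} * β {1} * β {2} = β {1} * (β {0} * β {2}) := by ring
      _ ≤ β {1} * β {0, 2} := mul_le_mul_of_nonneg_left k02 (h0 {1})
  have t3 : β {0} * β {1} * β {2} ≤ β {2} * β {0, 1} :=
    calc β {0} * β {1} * β {2} = β {2} * (β {0} * β {1}) := by ring
      _ ≤ β {2} * β {0, 1} := mul_le_mul_of_nonneg_left k01 (h0 {2})
  linarith [t1, t2, t3]

/-- **Abstract U(4)**: `Φ_4(β) ≤ 6(β_⊤ − β₀β₁β₂β₃)` for every nonnegative supermultiplicative set function on `Finset (Fin 4)`. [this work] -/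
theorem phiSet_four_le_top_gap (β : Finset (Fin 4) → ℝ) (h0 : ∀ B, 0 ≤ β B) (hsup : ∀ S T, β S * β T ≤ β (S ∪ T)) :
    PrincipalCapBeta.phiSet 4 β ≤ 6 * (β univ - β {0} * β {1} * β {2} * β {3}) := by
  rw [PrincipalCapBeta.phiSet_four]
  have a0 := h0 {0}; have a1 := h0 {1}; have a2 := h0 {2}; have a3 := h0 {3}
  have k01 : β {0} * β {1} ≤ β {0, 1} := by simpa using hsup {0} {1}
  have k02 : β {0} * β {2} ≤ β {0, 2} := by simpa using hsup {0} {2}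
  have k03 : β {0} * β {3} ≤ β {0, 3} := by simpa using hsup {0} {3}
  have k12 : β {1} * β {2} ≤ β {1, 2} := by simpa using hsup {1} {2}
  have k13 : β {1} * β {3} ≤ β {1, 3} := by simpa using hsup {1} {3}
  have k23 : β {2} * β {3} ≤ β {2, 3} := by simpa using hsup {2} {3}
  have h1_23 : β {1} * β {2, 3} ≤ β {1, 2, 3} := by
    have h := hsup {1} {2, 3}; rwa [show ({1} ∪ {2, 3} : Finset (Fin 4)) = {1, 2, 3} from by decide] at h
  have h2_13 : β {2} * β {1, 3} ≤ β {1, 2, 3} := by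
    have h := hsup {2} {1, 3}; rwa [show ({2} ∪ {1, 3} : Finset (Fin 4)) = {1, 2, 3} from by decide] at h
  have h0_12 : β {0} * β {1, 2} ≤ β {0, 1, 2} := by
    have h := hsup {0} {1, 2}; rwa [show ({0} ∪ {1, 2} : Finset (Fin 4)) = {0, 1, 2} from by decide] at h
  have h2_03 : β {2} * β {0, 3} ≤ β {0, 2, 3} := by
    have h := hsup {2} {0, 3}; rwa [show ({2} ∪ {0, 3} : Finset (Fin 4)) = {0, 2, 3} from by decide] at h
  have h3_02 : β {3} * β {0, 2} ≤ β {0, 2, 3} := by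
    have h := hsup {3} {0, 2}; rwa [show ({3} ∪ {0, 2} : Finset (Fin 4)) = {0, 2, 3} from by decide] at h
  have h3_01 : β {3} * β {0, 1} ≤ β {0, 1, 3} := by
    have h := hsup {3} {0, 1}; rwa [show ({3} ∪ {0, 1} : Finset (Fin 4)) = {0, 1, 3} from by decide] at h
  have t12 : β {0} * β {1} * β {2, 3} ≤ β {0} * β {1, 2, 3} :=
    calc β {0} * β {1} * β {2, 3} = β {0} * (β {1} * β {2, 3}) := by ring
      _ ≤ β {0} * β {1, 2, 3} := mul_le_mul_of_nonneg_left h1_23 a0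
  have t13 : β {0} * β {2} * β {1, 3} ≤ β {0} * β {1, 2, 3} :=
    calc β {0} * β {2} * β {1, 3} = β {0} * (β {2} * β {1, 3}) := by ring
      _ ≤ β {0} * β {1, 2, 3} := mul_le_mul_of_nonneg_left h2_13 a0
  have t14 : β {0} * β {3} * β {1, 2} ≤ β {3} * β {0, 1, 2} :=
    calc β {0} * β {3} * β {1, 2} = β {3} * (β {0} * β {1, 2}) := by ring
      _ ≤ β {3} * β {0, 1, 2} := mul_le_mul_of_nonneg_left h0_12 a3
  have t23 : β {1} * β {2} * β {0, 3} ≤ β {1} * β {0, 2, 3} :=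
    calc β {1} * β {2} * β {0, 3} = β {1} * (β {2} * β {0, 3}) := by ring
      _ ≤ β {1} * β {0, 2, 3} := mul_le_mul_of_nonneg_left h2_03 a1
  have t24 : β {1} * β {3} * β {0, 2} ≤ β {1} * β {0, 2, 3} :=
    calc β {1} * β {3} * β {0, 2} = β {1} * (β {3} * β {0, 2}) := by ring
      _ ≤ β {1} * β {0, 2, 3} := mul_le_mul_of_nonneg_left h3_02 a1
  have t34 : β {2} * β {3} * β {0, 1} ≤ β {2} * β {0, 1, 3} :=
    calc β {2} * β {3} * β {0, 1} = β {2} * (β {3} * β {0, 1}) := by ring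
      _ ≤ β {2} * β {0, 1, 3} := mul_le_mul_of_nonneg_left h3_01 a2
  have l3 : β {0} * β {1} * β {2} * β {3} ≤ β {2} * β {0, 1, 3} :=
    calc β {0} * β {1} * β {2} * β {3} = β {2} * (β {3} * (β {0} * β {1})) := by ring
      _ ≤ β {2} * (β {3} * β {0, 1}) := mul_le_mul_of_nonneg_left (mul_le_mul_of_nonneg_left k01 a3) a2
      _ ≤ β {2} * β {0, 1, 3} := mul_le_mul_of_nonneg_left h3_01 a2
  have l4 : β {0} * β {1} * β {2} * β {3} ≤ β {3} * β {0, 1, 2} :=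
    calc β {0} * β {1} * β {2} * β {3} = β {3} * (β {0} * (β {1} * β {2})) := by ring
      _ ≤ β {3} * (β {0} * β {1, 2}) := mul_le_mul_of_nonneg_left (mul_le_mul_of_nonneg_left k12 a0) a3
      _ ≤ β {3} * β {0, 1, 2} := mul_le_mul_of_nonneg_left h0_12 a3
  have q1 : β {0} * β {1} * β {2} * β {3} ≤ β {0, 1} * β {2, 3} :=
    calc β {0} * β {1} * β {2} * β {3} = (β {0} * β {1}) * (β {2} * β {3}) := by ring
      _ ≤ β {0, 1} * β {2, 3} := mul_le_mul k01 k23 (mul_nonneg a2 a3) (h0 _)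
  have q2 : β {0} * β {1} * β {2} * β {3} ≤ β {0, 2} * β {1, 3} :=
    calc β {0} * β {1} * β {2} * β {3} = (β {0} * β {2}) * (β {1} * β {3}) := by ring
      _ ≤ β {0, 2} * β {1, 3} := mul_le_mul k02 k13 (mul_nonneg a1 a3) (h0 _)
  have q3 : β {0} * β {1} * β {2} * β {3} ≤ β {0, 3} * β {1, 2} :=
    calc β {0} * β {1} * β {2} * β {3} = (β {0} * β {3}) * (β {1} * β {2}) := by ring
      _ ≤ β {0, 3} * β {1, 2} := mul_le_mul k03 k12 (mul_nonneg a1 a2) (h0 _)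
  linarith [t12, t13, t14, t23, t24, t34, l3, l4, q1, q2, q3]

/-! ### The conjecture U(n), typed (appended, gen 13) -/

/-- **Conjecture U(n) — the upper master inequality, abstract form**: for every nonnegative SUPERMULTIPLICATIVE set function `β` on `Finset (Fin n)`
(no normalisation of the top value), `Φ_n(β) ≤ (n−1)!·(β_⊤ − ∏_i β_i)`; equality for multiplicative `β`.  PROVED for `n = 3, 4`
(`phiSet_three_le_top_gap`, `phiSet_four_le_top_gap`); numerically true for `n ≤ 7` (memo §6); for events it follows from `C_{≤ n−2}` by the
`(12)`-transposition involution.  A conjecture-valued definition — never a fact. [this work] [status: open for n ≥ 5] -/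
@[conjecture] def PhiLeTopGap (n : ℕ) : Prop :=
  ∀ β : Finset (Fin n) → ℝ, (∀ B, 0 ≤ β B) → (∀ S T, β S * β T ≤ β (S ∪ T)) →
    PrincipalCapBeta.phiSet n β ≤ ((n - 1).factorial : ℝ) * (β univ - ∏ i, β {i})

/-- `U(3)` in the typed form. [this work] -/
theorem phiLeTopGap_three : PhiLeTopGap 3 := by
  intro β h0 hsup
  have h := phiSet_three_le_top_gap β h0 hsup
  have e : ∏ i : Fin 3, β {i} = β {0} * β {1} * β {2} := by
    rw [Fin.prod_univ_three]
  rw [e]; norm_num [Nat.factorial]; linarith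

/-- `U(4)` in the typed form. [this work] -/
theorem phiLeTopGap_four : PhiLeTopGap 4 := by
  intro β h0 hsup
  have h := phiSet_four_le_top_gap β h0 hsup
  have e : ∏ i : Fin 4, β {i} = β {0} * β {1} * β {2} * β {3} := by
    rw [Fin.prod_univ_four]
  rw [e]; norm_num [Nat.factorial]; linarith

end UpperMaster

end Summit.CriticalPhenomena.PercolationContinuityZ3.Theorems
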